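import Mathlib
import Summits.MatrixMultiplication.MatrixMultiplication.Theorems.GradedDesignFamily.Negative.CuspFormTrace
import Literature.NumberTheory.GaloisRepresentations.SL2WreathResidualImage

/-!
# The `q = 4` subfield cell `GL₂(F₁₆) ⊃ SL₂(F₄)` does not beat cubes
# (crux `LevelGradedCohnUmans.GradedDesignFamily`, stmt-MatrixMultiplication-7610; negative side,
# line `quadratic-extension-level-one-cell`, stub S3 `stub_subfieldCell`)

HONEST FRAMING.  This DECIDES one finite cell of stub S3 (`|k| = 4`, `|K| = 16`) as a theorem —
a VERDICT, not summit progress: in S3's configuration (any injective `φ : SL₂(k) →* GL₂(K)`,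
`|K| = |k|²`, `Y, Z` level-one separated against `φ(SL₂ k)`, S3's clause verbatim)

* `subfieldCell_sixteen_wall`: `|Y| + |Z| ≤ 52` — the trace-form wall
  (`subfieldCell_wall_of_traceForm`) with the cusp form `τ ∘ tr`, `τ(ω) = 1`, `τ(ω + 1) = −1`,
  `τ = 0` on `{0, 1}` (`ω ∈ F₄ ∖ F₂`; `a + a⁻¹ ∈ {0, 1}` for `a ∈ F₄ˣ`);
* `subfieldCell_sixteen_volume_le`: `|SL₂(F₄)|·|Y|·|Z| ≤ 60 · 26² = 40560`;
* `subfieldCell_sixteen_le_sumCubes`: `… < 72879 = 1 + 16³ + 14·17³`, the level-one sum of cubes.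

Sorry-free; axioms `propext`, `Classical.choice`, `Quot.sound`.
-/

set_option linter.dupNamespace false

open scoped BigOperators
open Matrix

namespace Summit.MatrixMultiplication.MatrixMultiplication.Theorems.GradedDesignFamily.Negative

/-- **`q = 4` wall**: `|Y| + |Z| ≤ 52` in the subfield cell over `|k| = 4`. [folklore] -/
theorem subfieldCell_sixteen_wall {k K : Type} [Field k] [Fintype k] [DecidableEq k] [Field K]
    [Fintype K] [DecidableEq K] (hk : Fintype.card k = 4)
    (φ : Matrix.SpecialLinearGroup (Fin 2) k →* Matrix.GeneralLinearGroup (Fin 2) K)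
    (hφ : Function.Injective φ) (hK : Fintype.card K = Fintype.card k ^ 2)
    (Y Z : Finset (Matrix.GeneralLinearGroup (Fin 2) K)) (hY : Y.Nonempty) (hZ : Z.Nonempty)
    (hsep : ∀ z₀ ∈ Z, ∃ cf : (Fin 2 → K) → (Fin 2 → K) → ℂ,
      ∀ a : Matrix.SpecialLinearGroup (Fin 2) k, ∀ y ∈ Y, ∀ y' ∈ Y, ∀ z ∈ Z,
        (∑ u : Fin 2 → K, cf u (((φ a * y * y'⁻¹ * z : Matrix.GeneralLinearGroup (Fin 2) K) :
            Matrix (Fin 2) (Fin 2) K).mulVec u)) =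
          if a = 1 ∧ y = y' ∧ z = z₀ then 1 else 0) :
    Y.card + Z.card ≤ 52 := by
  classical
  -- `char k = 2`
  have hchar : ringChar k = 2 := by
    obtain ⟨n, hp, hn⟩ := FiniteField.card k (ringChar k)
    rw [hk] at hn
    have hdvd : ringChar k ∣ 2 ^ 2 := by
      rw [show (2 : ℕ) ^ 2 = 4 by norm_num, hn]
      exact dvd_pow_self _ (PNat.ne_zero n)
    exact (Nat.prime_dvd_prime_iff_eq hp Nat.prime_two).1 (hp.dvd_of_dvd_pow hdvd)
  haveI : CharP k 2 := ringChar.eq_iff.1 hchar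
  have h2 : (2 : k) = 0 := by
    have := CharP.cast_eq_zero k 2
    simpa using this
  have h11 : (1 : k) + 1 = 0 := by rw [← two_mul, mul_one, h2]
  have hneg : (-1 : k) = 1 := neg_eq_of_add_eq_zero_left h11
  -- `a³ = 1` on `kˣ`
  have hcube : ∀ a : k, a ≠ 0 → a ^ 3 = 1 := by
    intro a ha
    have := FiniteField.pow_card_sub_one_eq_one a ha
    rwa [hk] at this
  -- an element `ω ∉ {0, 1}`
  have hω : ∃ ω : k, ω ≠ 0 ∧ ω ≠ 1 := by
    by_contra h
    push Not at h
    have hsub : (Finset.univ : Finset k) ⊆ {0, 1} := by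
      intro t _
      by_cases ht : t = 0
      · simp [ht]
      · simp [h t ht]
    have h1 := Finset.card_le_card hsub
    have h2' : ({0, 1} : Finset k).card ≤ 2 := (Finset.card_insert_le _ _).trans (by simp)
    rw [Finset.card_univ, hk] at h1
    omega
  obtain ⟨ω, hω0, hω1⟩ := hω
  have hω1' : ω + 1 ≠ 1 := fun h => hω0 (by simpa using h)
  have hω0' : ω + 1 ≠ 0 := fun h => hω1 (by
    have := neg_eq_of_add_eq_zero_left h
    rw [hneg] at this
    exact this.symm)
  -- the cusp form `τ ∘ tr`
  set τ : k → ℂ := fun t => (if t = ω then (1 : ℂ) else 0) - (if t = ω + 1 then 1 else 0) with hτ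
  have hsum : ∑ t : k, τ t = 0 := by
    simp [hτ, Finset.sum_sub_distrib]
  -- `a + a⁻¹ ∈ {0, 1}` for `a ≠ 0`
  have hval : ∀ a : k, a ≠ 0 → a + a⁻¹ = 0 ∨ a + a⁻¹ = 1 := by
    intro a ha
    by_cases ha1 : a = 1
    · left
      rw [ha1, inv_one, h11]
    · right
      have h3 : (a - 1) * (a ^ 2 + a + 1) = 0 := by
        have := hcube a ha
        linear_combination this
      have hq : a ^ 2 + a + 1 = 0 :=
        (mul_eq_zero.1 h3).resolve_left (sub_ne_zero.2 ha1)
      have e1 : a * (a + a⁻¹) = a * 1 := by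
        rw [mul_add, mul_inv_cancel₀ ha, mul_one]
        linear_combination hq - a * h2
      exact mul_left_cancel₀ ha e1
  have hcusp : ∀ a : k, a ≠ 0 → τ (a + a⁻¹) = 0 := by
    intro a ha
    rcases hval a ha with h | h
    · rw [h, hτ]
      simp only
      rw [if_neg (fun h' => hω0 h'.symm), if_neg (fun h' => hω0' h'.symm), sub_zero]
    · rw [h, hτ]
      simp only
      rw [if_neg (fun h' => hω1 h'.symm), if_neg (fun h' => hω1' h'.symm), sub_zero]
  -- a matrix of trace `ω`
  have hdet : Matrix.det !![ω, 1; 1, 0] = 1 := by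
    rw [Matrix.det_fin_two_of]
    linear_combination hneg
  have h0 : τ (Matrix.trace ((⟨!![ω, 1; 1, 0], hdet⟩ : Matrix.SpecialLinearGroup (Fin 2) k) :
      Matrix (Fin 2) (Fin 2) k)) ≠ 0 := by
    have htr : Matrix.trace ((⟨!![ω, 1; 1, 0], hdet⟩ : Matrix.SpecialLinearGroup (Fin 2) k) :
        Matrix (Fin 2) (Fin 2) k) = ω := by
      simp [Matrix.trace_fin_two]
    have hωω : ω ≠ ω + 1 := by
      intro h'
      have : (1 : k) = 0 := by simpa using h'.symm
      exact one_ne_zero this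
    rw [htr]
    show ((if ω = ω then (1 : ℂ) else 0) - (if ω = ω + 1 then 1 else 0)) ≠ 0
    rw [if_pos rfl, if_neg hωω]
    norm_num
  have wall := subfieldCell_wall_of_traceForm φ hφ hK Y Z hY hZ hsep τ hsum hcusp _ h0
  rw [hK, hk] at wall
  norm_num at wall
  exact wall

/-- **The `q = 4` subfield cell is empty at exponent three**: design volume
`|SL₂(k)|·|Y|·|Z| ≤ 60 · 676 = 40560`. [folklore] -/
theorem subfieldCell_sixteen_volume_le {k K : Type} [Field k] [Fintype k] [DecidableEq k]
    [Field K] [Fintype K] [DecidableEq K] (hk : Fintype.card k = 4)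
    (φ : Matrix.SpecialLinearGroup (Fin 2) k →* Matrix.GeneralLinearGroup (Fin 2) K)
    (hφ : Function.Injective φ) (hK : Fintype.card K = Fintype.card k ^ 2)
    (Y Z : Finset (Matrix.GeneralLinearGroup (Fin 2) K)) (hY : Y.Nonempty) (hZ : Z.Nonempty)
    (hsep : ∀ z₀ ∈ Z, ∃ cf : (Fin 2 → K) → (Fin 2 → K) → ℂ,
      ∀ a : Matrix.SpecialLinearGroup (Fin 2) k, ∀ y ∈ Y, ∀ y' ∈ Y, ∀ z ∈ Z,
        (∑ u : Fin 2 → K, cf u (((φ a * y * y'⁻¹ * z : Matrix.GeneralLinearGroup (Fin 2) K) :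
            Matrix (Fin 2) (Fin 2) K).mulVec u)) =
          if a = 1 ∧ y = y' ∧ z = z₀ then 1 else 0) :
    Nat.card (Matrix.SpecialLinearGroup (Fin 2) k) * Y.card * Z.card ≤ 40560 := by
  have hab := subfieldCell_sixteen_wall hk φ hφ hK Y Z hY hZ hsep
  have hcard : Nat.card (Matrix.SpecialLinearGroup (Fin 2) k) = 60 := by
    rw [Literature.NumberTheory.GaloisRepresentations.SL2Wreath.natCard_specialLinearGroup_fin_two,
      hk]; norm_num
  rw [hcard]
  have hprod : 4 * (Y.card * Z.card) ≤ (Y.card + Z.card) * (Y.card + Z.card) := by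
    nlinarith [Nat.zero_le (Y.card), Nat.zero_le (Z.card), sq_nonneg ((Y.card : ℤ) - Z.card)]
  have h52 : (Y.card + Z.card) * (Y.card + Z.card) ≤ 52 * 52 := Nat.mul_le_mul hab hab
  have : Y.card * Z.card ≤ 676 := by omega
  calc 60 * Y.card * Z.card = 60 * (Y.card * Z.card) := by ring
    _ ≤ 60 * 676 := Nat.mul_le_mul_left _ this
    _ ≤ 40560 := by norm_num

/-- The same, against the level-one sum of cubes `B₃(|K|) = 1 + |K|³ + (|K| − 2)(|K| + 1)³`
(`= 72879` at `|K| = 16`): the `q = 4` subfield cell does not beat cubes.  VERDICT for the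
`q = 4` instance of stub S3 (not summit progress). [folklore] -/
theorem subfieldCell_sixteen_le_sumCubes {k K : Type} [Field k] [Fintype k] [DecidableEq k]
    [Field K] [Fintype K] [DecidableEq K] (hk : Fintype.card k = 4)
    (φ : Matrix.SpecialLinearGroup (Fin 2) k →* Matrix.GeneralLinearGroup (Fin 2) K)
    (hφ : Function.Injective φ) (hK : Fintype.card K = Fintype.card k ^ 2)
    (Y Z : Finset (Matrix.GeneralLinearGroup (Fin 2) K)) (hY : Y.Nonempty) (hZ : Z.Nonempty)
    (hsep : ∀ z₀ ∈ Z, ∃ cf : (Fin 2 → K) → (Fin 2 → K) → ℂ,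
      ∀ a : Matrix.SpecialLinearGroup (Fin 2) k, ∀ y ∈ Y, ∀ y' ∈ Y, ∀ z ∈ Z,
        (∑ u : Fin 2 → K, cf u (((φ a * y * y'⁻¹ * z : Matrix.GeneralLinearGroup (Fin 2) K) :
            Matrix (Fin 2) (Fin 2) K).mulVec u)) =
          if a = 1 ∧ y = y' ∧ z = z₀ then 1 else 0) :
    Nat.card (Matrix.SpecialLinearGroup (Fin 2) k) * Y.card * Z.card <
      1 + Fintype.card K ^ 3 + (Fintype.card K - 2) * (Fintype.card K + 1) ^ 3 := by
  have h := subfieldCell_sixteen_volume_le hk φ hφ hK Y Z hY hZ hsep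
  have hcard : Nat.card (Matrix.SpecialLinearGroup (Fin 2) k) = 60 := by
    rw [Literature.NumberTheory.GaloisRepresentations.SL2Wreath.natCard_specialLinearGroup_fin_two,
      hk]; norm_num
  rw [hcard] at h ⊢
  rw [hK, hk]
  norm_num
  omega

end Summit.MatrixMultiplication.MatrixMultiplication.Theorems.GradedDesignFamily.Negative
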